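import Mathlib
import Literature.Analysis.FluidPDE.Tao2016AveragedNS.ShiftSetCascadeFlows
import Literature.Analysis.FluidPDE.Tao2016AveragedNS.ShiftSetCascadeFlux
import Summits.NavierStokesRegularity.NavierStokesRegularity.Theorems.TaoLadderRungTwoFlatHomogeneousL2Field
import Summits.NavierStokesRegularity.NavierStokesRegularity.Theorems.TaoLadderRungTwoFlatDatumExistence
import HarnessLib

/-!
# TAIL ENERGIES of finite-energy lattice solutions: the flux derivative `d/dt E_{>n} = 2B_𝕊(n)` and the ENERGY LIGHT
  CONE `E_{≥ n₀+j}(t) ≤ E·(Kt)^j/j!` (scale ratio `1`, any nearest-neighbour slot-closed `𝕊`, cancelling table)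
  (helper for item stmt-NavierStokesRegularity-22987 `FlatGapCertificatesV2`, crux K_A♭ of route TaoLadderRungTwoFlat;
  cell harvest/h2-tao-ladder, p1 g20 — the «energy-front speed ≲ sup|X|» statement behind theory-1 g36's SPLIT-T48
  junk-energy clause (bus l.673), in the `ℓ²` framework of `…HomogeneousL2Field` / `…DatumExistence`)

For a finite-energy state `U ∈ ℓ²(ℤ; ℝ^m)` the tail beyond shell `n`, `tailProj n U = 𝟙_{k>n}·U`, is a norm-one linear
projection (`tailProj`, `norm_tailProj_le`, `hasSum_norm_sq_tailProj`). Along an `ℓ²`-valued solution `W` of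
`Ẇ = l2Field W` the tail energy `E_{>n}(t) = ‖tailProj n (W t)‖²` is differentiable with
`Ė_{>n} = 2·B_𝕊(n)` — the shell-wise bookkeeping `∑ᵢ Q_{i,k}U_{i,k} = A(k) − A(k−1)` telescoped over `k > n`
(`inner_tailProj_l2Field`, `hasDerivAt_tailEnergy`). Since `|B_𝕊(n)| ≤ 4·C_b·R·(‖W_n‖² + ‖W_{n+1}‖²)`
(`C_b = coeffAbsOn (botShifts 𝕊) α`, `R` = amplitude bound) and the right side is part of the PREVIOUS tail, the tails obey
the cascade of differential inequalities `Ė_{>n} ≤ K·E_{>n−1}`, `K = 8C_bR`, whence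

* `tailEnergy_le_pow_div_factorial` — **if `W(0)` carries no energy beyond shell `n₀` and `‖W t‖ ≤ R` for `t ≥ 0`, then
  `‖tailProj (n₀ − 1 + j) (W t)‖² ≤ R²(Kt)^j/j!` for all `j : ℕ`, `t ≥ 0`**: energy spreads at most linearly in time
  (beyond `≈ e·K·t` shells it is factorially small) — the finite-energy counterpart of Tao's a priori decay (4.5).

HONEST FRAMING: elementary ODE estimates for MODEL lattices; nothing certified; nothing here is a statement about the
Navier–Stokes equations.
-/

noncomputable section

-- the sub-problem namespace repeats the summit name by design (D-0017)
set_option linter.dupNamespace false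

namespace Summit.NavierStokesRegularity.NavierStokesRegularity.Theorems

open Set Filter Metric Literature.Analysis.FluidPDE Literature.Analysis.FluidPDE.TaoCascade
open scoped Topology NNReal ENNReal RealInnerProductSpace Nat

namespace QuadPolar

variable {m : ℕ}

/-! ### The tail projection -/

/-- The tail of a state beyond shell `n` (shells `k > n` kept, the rest zeroed). [folklore] -/
def tailFun (n : ℤ) (U : lp (fun _ : ℤ => EuclideanSpace ℝ (Fin m)) 2) : ℤ → EuclideanSpace ℝ (Fin m) :=
  fun k => if n < k then U k else 0

/-- Shells of the tail are bounded by the shells of the state. [folklore] -/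
theorem norm_tailFun_le (n : ℤ) (U : lp (fun _ : ℤ => EuclideanSpace ℝ (Fin m)) 2) (k : ℤ) :
    ‖tailFun n U k‖ ≤ ‖U k‖ := by
  unfold tailFun; split_ifs <;> simp

/-- Squared shells of the tail. [folklore] -/
theorem norm_tailFun_sq (n : ℤ) (U : lp (fun _ : ℤ => EuclideanSpace ℝ (Fin m)) 2) (k : ℤ) :
    ‖tailFun n U k‖ ^ 2 = if n < k then ‖U k‖ ^ 2 else 0 := by
  unfold tailFun; split_ifs <;> simp

/-- The tail of a finite-energy state has finite energy. [folklore] -/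
theorem memℓp_tailFun (n : ℤ) (U : lp (fun _ : ℤ => EuclideanSpace ℝ (Fin m)) 2) : Memℓp (tailFun n U) 2 := by
  rw [memℓp_gen_iff (by norm_num : 0 < (2 : ℝ≥0∞).toReal)]
  simp only [ENNReal.toReal_ofNat, Real.rpow_two]
  exact Summable.of_nonneg_of_le (fun k => sq_nonneg _)
    (fun k => pow_le_pow_left₀ (norm_nonneg _) (norm_tailFun_le n U k) 2) (hasSum_norm_sq U).summable

/-- **The tail projection `U ↦ 𝟙_{k>n}·U` as a continuous linear map on `ℓ²(ℤ; ℝ^m)`.** [folklore] -/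
def tailProj (m : ℕ) (n : ℤ) :
    lp (fun _ : ℤ => EuclideanSpace ℝ (Fin m)) 2 →L[ℝ] lp (fun _ : ℤ => EuclideanSpace ℝ (Fin m)) 2 :=
  LinearMap.mkContinuous
    { toFun := fun U => ⟨tailFun n U, memℓp_tailFun n U⟩
      map_add' := fun U V => lp.ext (funext fun k => by
        show tailFun n (U + V) k = tailFun n U k + tailFun n V k
        unfold tailFun; split_ifs <;> simp)
      map_smul' := fun c U => lp.ext (funext fun k => by
        show tailFun n (c • U) k = c • tailFun n U k
        unfold tailFun; split_ifs <;> simp) } 1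
    fun U => by
      rw [one_mul]
      refine lp.norm_le_of_forall_sum_le (by norm_num : 0 < (2 : ℝ≥0∞).toReal) (norm_nonneg U) fun s => ?_
      simp only [ENNReal.toReal_ofNat, Real.rpow_two]
      calc ∑ k ∈ s, ‖tailFun n U k‖ ^ 2 ≤ ∑ k ∈ s, ‖U k‖ ^ 2 :=
            Finset.sum_le_sum fun k _ => pow_le_pow_left₀ (norm_nonneg _) (norm_tailFun_le n U k) 2
        _ ≤ ‖U‖ ^ 2 := sum_le_hasSum s (fun k _ => sq_nonneg _) (hasSum_norm_sq U)

/-- Shells of the tail projection. [folklore] -/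
theorem tailProj_apply (n : ℤ) (U : lp (fun _ : ℤ => EuclideanSpace ℝ (Fin m)) 2) (k : ℤ) :
    (tailProj m n U : ∀ _ : ℤ, EuclideanSpace ℝ (Fin m)) k = if n < k then U k else 0 := rfl

/-- The tail projection does not increase the norm. [folklore] -/
theorem norm_tailProj_le (n : ℤ) (U : lp (fun _ : ℤ => EuclideanSpace ℝ (Fin m)) 2) : ‖tailProj m n U‖ ≤ ‖U‖ := by
  have h := (tailProj m n).le_of_opNorm_le (LinearMap.mkContinuous_norm_le _ zero_le_one _) U
  rwa [one_mul] at h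

/-- **The tail energy is the sum of the squared shell norms beyond `n`.** [folklore] -/
theorem hasSum_norm_sq_tailProj (n : ℤ) (U : lp (fun _ : ℤ => EuclideanSpace ℝ (Fin m)) 2) :
    HasSum (fun k => if n < k then ‖U k‖ ^ 2 else 0) (‖tailProj m n U‖ ^ 2) := by
  have h := hasSum_norm_sq (tailProj m n U)
  refine h.congr_fun fun k => ?_
  show (if n < k then ‖U k‖ ^ 2 else 0) = ‖tailFun n U k‖ ^ 2
  rw [norm_tailFun_sq]

/-- Two consecutive shells beyond `n` are part of the tail energy: `‖U_{n+1}‖² + ‖U_{n+2}‖² ≤ E_{>n}`. [folklore] -/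
theorem two_shells_le_tailEnergy (n : ℤ) (U : lp (fun _ : ℤ => EuclideanSpace ℝ (Fin m)) 2) :
    ‖U (n + 1)‖ ^ 2 + ‖U (n + 1 + 1)‖ ^ 2 ≤ ‖tailProj m n U‖ ^ 2 := by
  have hne : n + 1 ≠ n + 1 + 1 := by omega
  have h := sum_le_hasSum ({n + 1, n + 1 + 1} : Finset ℤ) (fun k _ => by positivity) (hasSum_norm_sq_tailProj n U)
  rw [Finset.sum_pair hne, if_pos (by omega), if_pos (by omega)] at h
  exact h

/-- The tail vanishes when the state carries nothing beyond shell `n`. [folklore] -/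
theorem tailProj_eq_zero_of_support {n : ℤ} {U : lp (fun _ : ℤ => EuclideanSpace ℝ (Fin m)) 2}
    (h : ∀ k, n < k → U k = 0) : tailProj m n U = 0 := by
  refine lp.ext (funext fun k => ?_)
  show tailFun n U k = 0
  unfold tailFun
  split_ifs with hk
  · exact h k hk
  · rfl

/-! ### The flux derivative of the tail energy -/

/-- Inner products of tails: `⟪𝟙_{>n}U, 𝟙_{>n}V⟫ = Σ_{k>n} ⟪U_k, V_k⟫`. [folklore] -/
theorem inner_tailProj_tailProj (n : ℤ) (U V : lp (fun _ : ℤ => EuclideanSpace ℝ (Fin m)) 2) :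
    ⟪tailProj m n U, tailProj m n V⟫ = ∑' k : ℤ, if n < k then ⟪U k, V k⟫ else 0 := by
  rw [lp.inner_eq_tsum]
  refine tsum_congr fun k => ?_
  show ⟪tailFun n U k, tailFun n V k⟫ = _
  unfold tailFun
  split_ifs <;> simp

/-- **`⟪𝟙_{>n}U, 𝟙_{>n}Q(U)⟫ = B_𝕊(n)`**: the energy fed into the tail beyond `n` per unit time is the bond flux through
`n | n+1` (shell-wise bookkeeping `∑ᵢ Q_{i,k}U_{i,k} = A(k) − A(k−1)` telescoped over `k > n`; `A(n) = −B(n)`).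
[cite: Tao2016AveragedNS, §4 (4.3) and proof of Lemma 4.1 (v)] -/
theorem inner_tailProj_l2Field {𝕊 : Finset (ℤ × ℤ × ℤ)} (h𝕊 : IsNearestNeighbourSet 𝕊) (h𝕊' : IsSlotClosed 𝕊)
    {α : Fin m → Fin m → Fin m → ℤ × ℤ × ℤ → ℝ} (hα : IsCancellingCoeffOn 𝕊 α)
    (U : lp (fun _ : ℤ => EuclideanSpace ℝ (Fin m)) 2) (n : ℤ) :
    ⟪tailProj m n U, tailProj m n (l2Field h𝕊 α U)⟫ = botSumOn 𝕊 0 α (l2Fam U) n 0 := by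
  set top : ℤ → ℝ := fun k => topSumOn 𝕊 0 α (l2Fam U) k 0 with htop
  have hs : Summable top := summable_topSumOn_l2Fam h𝕊 α U
  set f : ℤ → ℝ := fun k => if n < k then top k else 0 with hf
  set g : ℤ → ℝ := fun k => if n < k then top (k - 1) else 0 with hg
  have hfs : Summable f := Summable.of_norm_bounded (g := fun k => ‖top k‖) hs.norm fun k => by
    simp only [hf]; split_ifs <;> simp
  have hs' : Summable fun k => top (k - 1) := by
    simpa [Function.comp_def] using (Equiv.subRight (1 : ℤ)).summable_iff.2 hs
  have hgs : Summable g := Summable.of_norm_bounded (g := fun k => ‖top (k - 1)‖) hs'.norm fun k => by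
    simp only [hg]; split_ifs <;> simp
  -- pointwise: the summand is f k − g k
  have hpt : ∀ k, (if n < k then ⟪U k, (l2Field h𝕊 α U : ∀ _ : ℤ, EuclideanSpace ℝ (Fin m)) k⟫ else 0) = f k - g k := by
    intro k
    simp only [hf, hg]
    split_ifs with hk
    · rw [real_inner_comm, inner_l2Field_apply h𝕊 h𝕊' hα U k]
    · simp
  -- shifting g: g (k+1) = f k + [k = n] top n
  have hshift : ∀ k, g (k + 1) = f k + if k = n then top k else 0 := by
    intro k
    simp only [hf, hg, add_sub_cancel_right]
    rcases lt_trichotomy k n with hkn | hkn | hkn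
    · rw [if_neg (by omega), if_neg (by omega), if_neg (by omega)]; ring
    · subst hkn; rw [if_pos (by omega), if_neg (lt_irrefl _), if_pos rfl]; ring
    · rw [if_pos (by omega), if_pos hkn, if_neg (by omega)]; ring
  have hg_sum : ∑' k, g k = ∑' k, f k + top n := by
    have e1 : ∑' k, g k = ∑' k, g (k + 1) := ((Equiv.addRight (1 : ℤ)).tsum_eq g).symm
    have hδ : Summable fun k : ℤ => if k = n then top k else 0 := by
      refine Summable.of_norm_bounded (g := fun k => ‖top k‖) hs.norm fun k => ?_
      split_ifs <;> simp
    rw [e1]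
    simp_rw [hshift]
    rw [hfs.tsum_add hδ, tsum_ite_eq]
  rw [inner_tailProj_tailProj]
  simp_rw [hpt]
  rw [hfs.tsum_sub hgs, hg_sum, botSumOn_eq_neg_topSumOn h𝕊' h𝕊.out_eq_zero_or_one 0 hα]
  simp [htop]

/-- **THE TAIL ENERGY IS DIFFERENTIABLE WITH DERIVATIVE `2B_𝕊(n)`** along an `ℓ²`-valued solution of the homogeneous
lattice. [cite: Tao2016AveragedNS, §4 (4.9) and proof of Lemma 4.1 (v)] -/
theorem hasDerivAt_tailEnergy {𝕊 : Finset (ℤ × ℤ × ℤ)} (h𝕊 : IsNearestNeighbourSet 𝕊) (h𝕊' : IsSlotClosed 𝕊)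
    {α : Fin m → Fin m → Fin m → ℤ × ℤ × ℤ → ℝ} (hα : IsCancellingCoeffOn 𝕊 α)
    {W : ℝ → lp (fun _ : ℤ => EuclideanSpace ℝ (Fin m)) 2} {t : ℝ} (hW : HasDerivAt W (l2Field h𝕊 α (W t)) t)
    (n : ℤ) :
    HasDerivAt (fun s => ‖tailProj m n (W s)‖ ^ 2) (2 * botSumOn 𝕊 0 α (l2Fam (W t)) n 0) t := by
  have h1 := ((tailProj m n).hasFDerivAt.comp_hasDerivAt t hW).norm_sq
  have h2 : HasDerivAt (fun s => ‖tailProj m n (W s)‖ ^ 2)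
      (2 * ⟪tailProj m n (W t), tailProj m n (l2Field h𝕊 α (W t))⟫) t := by
    simpa [Function.comp_def] using h1
  rwa [inner_tailProj_l2Field h𝕊 h𝕊' hα] at h2

/-! ### The energy light cone -/

/-- The bond flux of a finite-energy state is controlled by the two adjacent shells:
`|B_𝕊(n)| ≤ 4·C_b·R·(‖U_n‖² + ‖U_{n+1}‖²)` when `‖U‖ ≤ R` (`C_b = Σ_{botShifts}|α|`).
[cite: Tao2016AveragedNS, §4 proof of Lemma 4.1 (v) (the boundary terms)] -/
theorem abs_botSumOn_l2Fam_le {𝕊 : Finset (ℤ × ℤ × ℤ)} (h𝕊 : IsNearestNeighbourSet 𝕊)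
    (α : Fin m → Fin m → Fin m → ℤ × ℤ × ℤ → ℝ) {U : lp (fun _ : ℤ => EuclideanSpace ℝ (Fin m)) 2} {R : ℝ}
    (hR : ‖U‖ ≤ R) (n : ℤ) :
    |botSumOn 𝕊 0 α (l2Fam U) n 0| ≤ 4 * coeffAbsOn (botShifts 𝕊) α * R * (‖U n‖ ^ 2 + ‖U (n + 1)‖ ^ 2) := by
  set M : ℝ := ‖U n‖ + ‖U (n + 1)‖ with hM
  have hM0 : 0 ≤ M := by positivity
  have hX : ∀ i, |l2Fam U i n 0| ≤ M ∧ |l2Fam U i (n + 1) 0| ≤ M := fun i =>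
    ⟨(abs_l2Fam_le_norm_apply U i n 0).trans (by rw [hM]; linarith [norm_nonneg (U (n + 1))]),
      (abs_l2Fam_le_norm_apply U i (n + 1) 0).trans (by rw [hM]; linarith [norm_nonneg (U n)])⟩
  have h := abs_botSumOn_le_of_abs_le h𝕊 0 (by norm_num) α (l2Fam U) n 0 hM0 hX
  simp only [Real.one_rpow, one_mul, add_zero] at h
  have hC := coeffAbsOn_nonneg (botShifts 𝕊) α
  have h1 := lp.norm_apply_le_norm (by norm_num : (2 : ℝ≥0∞) ≠ 0) U n
  have h2 := lp.norm_apply_le_norm (by norm_num : (2 : ℝ≥0∞) ≠ 0) U (n + 1)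
  have hR0 : 0 ≤ R := (norm_nonneg _).trans hR
  have hMle : M ≤ 2 * R := by rw [hM]; linarith
  have hM2 : M ^ 2 ≤ 2 * (‖U n‖ ^ 2 + ‖U (n + 1)‖ ^ 2) := by
    rw [hM]; nlinarith [sq_nonneg (‖U n‖ - ‖U (n + 1)‖)]
  calc |botSumOn 𝕊 0 α (l2Fam U) n 0| ≤ M ^ 3 * coeffAbsOn (botShifts 𝕊) α := h
    _ = M * M ^ 2 * coeffAbsOn (botShifts 𝕊) α := by ring
    _ ≤ (2 * R) * (2 * (‖U n‖ ^ 2 + ‖U (n + 1)‖ ^ 2)) * coeffAbsOn (botShifts 𝕊) α := by gcongr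
    _ = 4 * coeffAbsOn (botShifts 𝕊) α * R * (‖U n‖ ^ 2 + ‖U (n + 1)‖ ^ 2) := by ring

/-- **THE ENERGY LIGHT CONE.** Along an `ℓ²`-valued solution `W` of the homogeneous lattice with `‖W t‖ ≤ R` for
`t ≥ 0` and NO energy beyond shell `n₀` at time `0`, the tail energies obey
`‖tailProj (n₀ − 1 + j) (W t)‖² ≤ R²·(8C_bR·t)^j/j!` for every `j : ℕ` and `t ≥ 0` (`C_b = coeffAbsOn (botShifts 𝕊) α`):
energy reaches `j` shells beyond its initial support no faster than the factorial light cone — the energy front moves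
at most linearly, speed `≲ C_b·R`. [cite: Tao2016AveragedNS, §4 Lemma 4.1 (4.5) (a priori decay, statement shape) and proof of (v)] -/
theorem tailEnergy_le_pow_div_factorial {𝕊 : Finset (ℤ × ℤ × ℤ)} (h𝕊 : IsNearestNeighbourSet 𝕊)
    (h𝕊' : IsSlotClosed 𝕊) {α : Fin m → Fin m → Fin m → ℤ × ℤ × ℤ → ℝ} (hα : IsCancellingCoeffOn 𝕊 α)
    {W : ℝ → lp (fun _ : ℤ => EuclideanSpace ℝ (Fin m)) 2} (hW : ∀ t, HasDerivAt W (l2Field h𝕊 α (W t)) t)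
    {R : ℝ} (hR : ∀ t, 0 ≤ t → ‖W t‖ ≤ R) {n₀ : ℤ}
    (hsupp : ∀ k, n₀ < k → (W 0 : ∀ _ : ℤ, EuclideanSpace ℝ (Fin m)) k = 0) :
    ∀ (j : ℕ) (t : ℝ), 0 ≤ t →
      ‖tailProj m (n₀ - 1 + j) (W t)‖ ^ 2 ≤ R ^ 2 * (8 * coeffAbsOn (botShifts 𝕊) α * R * t) ^ j / j ! := by
  set K : ℝ := 8 * coeffAbsOn (botShifts 𝕊) α * R with hK
  have hR0 : 0 ≤ R := (norm_nonneg _).trans (hR 0 le_rfl)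
  have hC := coeffAbsOn_nonneg (botShifts 𝕊) α
  have hK0 : 0 ≤ K := by rw [hK]; positivity
  intro j
  induction j with
  | zero =>
    intro t ht
    have h := (norm_tailProj_le (n₀ - 1 + (0 : ℕ)) (W t)).trans (hR t ht)
    have h2 : ‖tailProj m (n₀ - 1 + (0 : ℕ)) (W t)‖ ^ 2 ≤ R ^ 2 := pow_le_pow_left₀ (norm_nonneg _) h 2
    simpa using h2
  | succ j ih =>
    intro t ht
    set n : ℤ := n₀ - 1 + (j + 1 : ℕ) with hn
    have hn' : n₀ - 1 + (j : ℕ) = n - 1 := by rw [hn]; push_cast; ring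
    -- the tail energy beyond n, its derivative and the bound K × (previous tail)
    set f : ℝ → ℝ := fun s => ‖tailProj m n (W s)‖ ^ 2 with hf
    have hfd : ∀ s, HasDerivAt f (2 * botSumOn 𝕊 0 α (l2Fam (W s)) n 0) s := fun s =>
      hasDerivAt_tailEnergy h𝕊 h𝕊' hα (hW s) n
    have hf0 : f 0 = 0 := by
      have h0 : tailProj m n (W 0) = 0 :=
        tailProj_eq_zero_of_support fun k hk => hsupp k (by rw [hn] at hk; push_cast at hk; omega)
      simp [hf, h0]
    have hbound : ∀ s, 0 ≤ s → |2 * botSumOn 𝕊 0 α (l2Fam (W s)) n 0| ≤ K * (R ^ 2 * (K * s) ^ j / j !) := by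
      intro s hs
      have h1 := abs_botSumOn_l2Fam_le h𝕊 α (hR s hs) n
      have h2 := two_shells_le_tailEnergy (n - 1) (W s)
      rw [sub_add_cancel] at h2
      have h3 := ih s hs
      rw [hn'] at h3
      rw [abs_mul, abs_two]
      calc 2 * |botSumOn 𝕊 0 α (l2Fam (W s)) n 0|
          ≤ 2 * (4 * coeffAbsOn (botShifts 𝕊) α * R * (‖W s n‖ ^ 2 + ‖W s (n + 1)‖ ^ 2)) := by linarith
        _ = K * (‖W s n‖ ^ 2 + ‖W s (n + 1)‖ ^ 2) := by rw [hK]; ring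
        _ ≤ K * ‖tailProj m (n - 1) (W s)‖ ^ 2 := mul_le_mul_of_nonneg_left h2 hK0
        _ ≤ K * (R ^ 2 * (K * s) ^ j / j !) := mul_le_mul_of_nonneg_left h3 hK0
    -- comparison with B(s) = R² (Ks)^{j+1}/(j+1)!
    set B : ℝ → ℝ := fun s => R ^ 2 * (K * s) ^ (j + 1) / (j + 1)! with hB
    have hBd : ∀ s, HasDerivAt B (K * (R ^ 2 * (K * s) ^ j / j !)) s := by
      intro s
      have h1 : HasDerivAt (fun s => (K * s) ^ (j + 1)) ((j + 1 : ℕ) * (K * s) ^ j * K) s := by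
        have hg : HasDerivAt (fun s : ℝ => K * s) K s := by simpa using (hasDerivAt_id s).const_mul K
        exact hg.pow (j + 1)
      have h2 := (h1.const_mul (R ^ 2)).div_const ((j + 1)! : ℝ)
      refine h2.congr_deriv ?_
      rw [Nat.factorial_succ]
      push_cast
      field_simp
    have hfc : ContinuousOn f (Icc 0 t) := fun s _ => (hfd s).continuousAt.continuousWithinAt
    have hcmp := image_norm_le_of_norm_deriv_right_le_deriv_boundary hfc
      (fun s _ => (hfd s).hasDerivWithinAt) (B := B) (by simp [hf0, hB]) hBd
      (fun s hs => by rw [Real.norm_eq_abs]; exact hbound s hs.1) (right_mem_Icc.2 ht)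
    rw [Real.norm_eq_abs, abs_of_nonneg (by positivity)] at hcmp
    simpa [hB] using hcmp

end QuadPolar

end Summit.NavierStokesRegularity.NavierStokesRegularity.Theorems

end
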